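import Summits.QuantumFields.YangMills.Theorems.UnitScaleTiltFluctuationComparisonRegPrTwoCutoffKerHeightFree
import HarnessLib

/-!
# `UnitScaleTiltFluctuationComparisonRegPrTwoCutoffRefUnique` — THE REFERENCE KERNELS OF (R1) ARE UNIQUE, AND PER-RUN CLOSENESS TRANSFERS ACROSS FAMILIES
# (crux `FluctuationComparisonRegPrIntL`, stmt-QuantumFields-20520, STUB 3⁗χ; cell `pub/ym-inputs`, INPUT-LIST I-11 row p10, seat ym-inputs-p10 g2, file 4; count-neutral helper, def-free)

WHY.  Files 2–3 (`…TwoCutoffKerHeightFree`, `…TwoCutoffRefCfgCoherent`) CONSTRUCT the reference objects of 3⁗χ's per-run currency from one-family two-run rows.  Two bookkeeping facts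
make the construction usable by a per-run record (NODE O ∕ (α)) whose charts are per-`K` choice witnesses (F-g4-1):
* §1 TRANSFER (triangle inequality, own-indexed rows): if the witness family is per-run close to a canonical family — `‖(ker Φ − ker Φ₀)_{K,b,Y,d} ∘ D_w^{⊗d}‖ ≤ C₁·e^{−κ𝓛}·(L^{−(1+b)})^a`
  for every index, ONE run at a time — and the canonical family carries (R1) against `Ψ` with constant `C₀`, then the witness family carries (R1) against the SAME `Ψ` with `C₀ + C₁`
  (`kernelRefOwnΦ_of_near`); likewise `cfgRefOwnΦ_of_near` for the loop variables.
* §2 UNIQUENESS (canonicity of the reference): two height-free families that both carry (R1) against one family `Φ` have THE SAME flat kernels of orders `2…6` at every index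
  (`ker_eq_of_kerHeightFree_of_refOwn`; matched distances, tree length non-decreasing under refinement, `0 ≤ κ`, `1 < L`, `0 < a`): height-freeness moves the comparison up the tower
  `(K+n, b+n, refineSetⁿ Y)` at no cost (`norm_kerT_sub_compLegL_le`) while the budget there decays like `(L⁻¹)^{an}` — so «a FIXED height-free reference family» in (R1) involves no
  choice at the level of kernels: it is determined by `Φ`.
HONEST FRAMING.  Triangle inequalities and a geometric-decay limit over the tree's hypothesis schemas; nothing of [King1986] ∕ [Balaban1985UV3] is asserted; no stub, crux or registry
object is touched; no summit or sub-problem statement is proved; YM₃ on T³ is a ladder rung (R3), not the Clay problem ∕ 𝕋⁴ ∕ a mass gap.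

References: C. King, CMP 102 (1986) 649–677 [King1986] (Prop. 3.6 (3.56) p.662, (3.58)–(3.61) p.663, Prop. 3.9 (3.71)–(3.72) p.665); T. Bałaban, CMP 102 (1985) 255–275
[Balaban1985UV3] ((43)–(45) pp.266–267).
-/

set_option autoImplicit false

noncomputable section

open Filter Topology
open scoped BigOperators
open Literature.MathematicalPhysics.QuantumFieldTheory.Balaban1983to89
open Literature.MathematicalPhysics.QuantumFieldTheory.Balaban1983to89.T3ContinuumYM3Torus
open Literature.MathematicalPhysics.QuantumFieldTheory.Balaban1983to89.T3UnitScaleTilt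
open Literature.MathematicalPhysics.QuantumFieldTheory.Balaban1983to89.T3LevelShift
open Literature.MathematicalPhysics.QuantumFieldTheory.Balaban1983to89.T3AlphaPolymerSocket
open Literature.MathematicalPhysics.QuantumFieldTheory.Balaban1983to89.T3AlphaInputsAC
open Literature.MathematicalPhysics.QuantumFieldTheory.Balaban1985CMP102
open Literature.MathematicalPhysics.QuantumFieldTheory.Balaban1985CMP102.Setting
open Summit.QuantumFields.Balaban3D.Carriers
open Summit.QuantumFields.Balaban3D.Proofs.Primitives
open Summit.QuantumFields.YangMills.Theorems
open Summit.QuantumFields.YangMills.Theorems.GlobalSlackKernelMatching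
open Summit.QuantumFields.YangMills.Theorems.GlobalSlackKernelLeg
open Summit.QuantumFields.YangMills.Theorems.TwoCutoffTowerLimit

namespace Summit.QuantumFields.YangMills.Theorems.TwoCutoffRefUnique

/-! ## §1 Transfer of the own-indexed per-run rows across families -/

section Transfer

variable {𝕍 : Type} [NormedAddCommGroup 𝕍] [NormedSpace ℂ 𝕍] {F : T3Family} {γ : ℝ}

/-- Precomposition with one linear map in every slot commutes with addition. [folklore] -/
theorem add_compContinuousLinearMap {E₀ : Type*} [NormedAddCommGroup E₀] [NormedSpace ℂ E₀] {n : ℕ}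
    (M₁ M₂ : ContinuousMultilinearMap ℂ (fun _ : Fin n => E₀) ℂ) (T : E₀ →L[ℂ] E₀) :
    (M₁ + M₂).compContinuousLinearMap (fun _ => T) = M₁.compContinuousLinearMap (fun _ => T) + M₂.compContinuousLinearMap (fun _ => T) := by
  ext v
  simp [ContinuousMultilinearMap.compContinuousLinearMap_apply]

/-- **(R1) TRANSFERS ALONG PER-RUN CLOSENESS OF FAMILIES**: if `Φ₀` carries `KernelRefOwnΦ D Φ₀ Ψ dist κ′ κ a C₀` and the family `Φ` is own-indexed close to `Φ₀`,
`‖(ker Φ − ker Φ₀)_{K,b,Y,d} ∘ D_w^{⊗d}‖ ≤ C₁·e^{−κ𝓛_K(1+b,Y)}·(L^{−(1+b)})^a` (each clause about ONE run), then `KernelRefOwnΦ D Φ Ψ dist κ′ κ a (C₀ + C₁)`. [cite: King1986, Prop. 3.6 (3.56) p.662] -/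
theorem kernelRefOwnΦ_of_near {D : AlphaDataT3 F γ} {Φ Φ₀ Ψ : ChartFam 𝕍 F} {dist : LegDist F} {κ' κ a C₀ C₁ : ℝ}
    (h₀ : KernelRefOwnΦ D Φ₀ Ψ dist κ' κ a C₀)
    (hnear : ∀ (K b : ℕ) (Y : Set (Site (F.P K) 0)), ∀ d ∈ Finset.Ico 2 7,
      ‖(ker Φ K b Y d - ker Φ₀ K b Y d).compContinuousLinearMap fun _ => legL 𝕍 dist κ' K b Y‖ ≤
        C₁ * Real.exp (-κ * D.treeLen K (1 + b) Y) * (((F.L : ℝ) ^ (1 + b))⁻¹) ^ a) :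
    KernelRefOwnΦ D Φ Ψ dist κ' κ a (C₀ + C₁) := by
  intro K b Y d hd
  have hsplit : ker Φ K b Y d - ker Ψ K b Y d = (ker Φ K b Y d - ker Φ₀ K b Y d) + (ker Φ₀ K b Y d - ker Ψ K b Y d) := by abel
  rw [hsplit, add_compContinuousLinearMap]
  refine (norm_add_le _ _).trans ?_
  have h1 := hnear K b Y d hd
  have h2 := h₀ K b Y d hd
  calc _ ≤ C₁ * Real.exp (-κ * D.treeLen K (1 + b) Y) * (((F.L : ℝ) ^ (1 + b))⁻¹) ^ a +
        C₀ * Real.exp (-κ * D.treeLen K (1 + b) Y) * (((F.L : ℝ) ^ (1 + b))⁻¹) ^ a := add_le_add h1 h2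
    _ = (C₀ + C₁) * Real.exp (-κ * D.treeLen K (1 + b) Y) * (((F.L : ℝ) ^ (1 + b))⁻¹) ^ a := by ring

omit [NormedSpace ℂ 𝕍] in
/-- **(R5) TRANSFERS ALONG PER-RUN CLOSENESS OF CONFIGURATION FAMILIES**: `CfgRefOwnΦ D B₀ BR dist b₀ p₀ a C₀` and own-indexed closeness of `B` to `B₀` on run `K`'s window and
domains (budget `C₁·(1+d(c))·θ(n)·x²·(L^{−(1+j)})^a`) give `CfgRefOwnΦ D B BR dist b₀ p₀ a (C₀ + C₁)`. [cite: King1986, Prop. 3.9 (3.71)-(3.72) p.665; Balaban1985UV3, (44) p.267] -/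
theorem cfgRefOwnΦ_of_near {D : AlphaDataT3 F γ} {B B₀ BR : CfgFam 𝕍 F} {dist : LegDist F} {b₀ p₀ a C₀ C₁ : ℝ}
    (h₀ : CfgRefOwnΦ D B₀ BR dist b₀ p₀ a C₀)
    (hnear : ∀ (K n : ℕ) (h : n ≤ K), ∀ j : ℕ, j < K - n →
      ∀ V : GaugeField (F.P n) 0 (Matrix.specialUnitaryGroup (Fin 2) ℂ), PlaqSmall (θBal F.L γ b₀ p₀ n) V →
        ∀ Y ∈ D.Loc K (K - n) (D.triv K (K - n)) (1 + j), ∀ c : PBond (F.P K) j,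
          ‖B K (K - n) j Y (fieldShift (F.sitesPerDir_eq (m := F.m) (K := K) (j := K - n) (m' := F.m) (K' := n) (j' := 0) (by omega)) V) c -
              B₀ K (K - n) j Y (fieldShift (F.sitesPerDir_eq (m := F.m) (K := K) (j := K - n) (m' := F.m) (K' := n) (j' := 0) (by omega)) V) c‖ ≤
            C₁ * (1 + dist K j Y c) * θBal F.L γ b₀ p₀ n * (((F.L : ℝ) ^ (K - n - 1 - j))⁻¹) ^ 2 * (((F.L : ℝ) ^ (1 + j))⁻¹) ^ a) :
    CfgRefOwnΦ D B BR dist b₀ p₀ a (C₀ + C₁) := by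
  intro K n hn j hj V hV Y hY c
  have h1 := hnear K n hn j hj V hV Y hY c
  have h2 := h₀ K n hn j hj V hV Y hY c
  calc _ ≤ ‖B K (K - n) j Y (fieldShift (F.sitesPerDir_eq (m := F.m) (K := K) (j := K - n) (m' := F.m) (K' := n) (j' := 0) (by omega)) V) c -
          B₀ K (K - n) j Y (fieldShift (F.sitesPerDir_eq (m := F.m) (K := K) (j := K - n) (m' := F.m) (K' := n) (j' := 0) (by omega)) V) c‖ +
        ‖B₀ K (K - n) j Y (fieldShift (F.sitesPerDir_eq (m := F.m) (K := K) (j := K - n) (m' := F.m) (K' := n) (j' := 0) (by omega)) V) c -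
          BR K (K - n) j Y (fieldShift (F.sitesPerDir_eq (m := F.m) (K := K) (j := K - n) (m' := F.m) (K' := n) (j' := 0) (by omega)) V) c‖ :=
        norm_sub_le_norm_sub_add_norm_sub _ _ _
    _ ≤ C₁ * (1 + dist K j Y c) * θBal F.L γ b₀ p₀ n * (((F.L : ℝ) ^ (K - n - 1 - j))⁻¹) ^ 2 * (((F.L : ℝ) ^ (1 + j))⁻¹) ^ a +
        C₀ * (1 + dist K j Y c) * θBal F.L γ b₀ p₀ n * (((F.L : ℝ) ^ (K - n - 1 - j))⁻¹) ^ 2 * (((F.L : ℝ) ^ (1 + j))⁻¹) ^ a := add_le_add h1 h2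
    _ = (C₀ + C₁) * (1 + dist K j Y c) * θBal F.L γ b₀ p₀ n * (((F.L : ℝ) ^ (K - n - 1 - j))⁻¹) ^ 2 * (((F.L : ℝ) ^ (1 + j))⁻¹) ^ a := by ring

end Transfer

/-! ## §2 Uniqueness of the height-free reference kernels -/

section Unique

variable {𝕍 : Type} [NormedAddCommGroup 𝕍] [NormedSpace ℂ 𝕍] {F : T3Family} {γ : ℝ}

/-- **CLIMBING THE TOWER**: for two HEIGHT-FREE families, the weighted kernel difference at `(K, b, Y)` is at most the one at `(K+1, b+1, refineSet Y)` (matched distances: the transport is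
a contraction, `norm_kerT_sub_compLegL_le`). [cite: King1986, Prop. 3.6 (3.56) p.662, (3.58)-(3.61) p.663] -/
theorem norm_sub_compLegL_le_succ_of_kerHeightFree {Ψ₁ Ψ₂ : ChartFam 𝕍 F} (h₁ : KerHeightFree Ψ₁) (h₂ : KerHeightFree Ψ₂) {dist : LegDist F} (hm : DistMatched dist)
    (κ' : ℝ) (K b : ℕ) (Y : Set (Site (F.P K) 0)) {d : ℕ} (hd : d ∈ Finset.Ico 2 7) :
    ‖(ker Ψ₁ K b Y d - ker Ψ₂ K b Y d).compContinuousLinearMap (fun _ => legL 𝕍 dist κ' K b Y)‖ ≤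
      ‖(ker Ψ₁ (K + 1) (b + 1) (refineSet F K Y) d - ker Ψ₂ (K + 1) (b + 1) (refineSet F K Y) d).compContinuousLinearMap
          fun _ => legL 𝕍 dist κ' (K + 1) (b + 1) (refineSet F K Y)‖ := by
  rw [← h₁ K b Y d hd, ← h₂ K b Y d hd]
  exact norm_kerT_sub_compLegL_le hm κ' Ψ₁ Ψ₂ K b Y d

/-- **THE HEIGHT-FREE REFERENCE KERNELS OF (R1) ARE UNIQUE.**  Matched distances, tree length non-decreasing under the refinement for every point set, `0 ≤ κ`, `1 < L`, `0 < a`: if two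
height-free families `Ψ₁`, `Ψ₂` both carry the own-indexed per-run row against ONE family `Φ` (`KernelRefOwnΦ D Φ Ψᵢ dist κ′ κ a Cᵢ`), then `ker Ψ₁ K b Y d = ker Ψ₂ K b Y d` for every
index and every order `d ∈ [2,7)` — climbing `n` steps costs nothing (height-freeness) while the budget at height `n` is `(C₁+C₂)·e^{−κ𝓛}·(L^{−(1+b)})^a·((L⁻¹)^a)^n → 0`.  So the
«FIXED height-free reference family» of (R1) is determined by `Φ` at the level of flat kernels (the charts themselves are free off their `6`-jets). [cite: King1986, Prop. 3.6 (3.56) p.662, (3.58)-(3.61) p.663] -/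
theorem ker_eq_of_kerHeightFree_of_refOwn {D : AlphaDataT3 F γ} {Φ Ψ₁ Ψ₂ : ChartFam 𝕍 F} {dist : LegDist F} (hm : DistMatched dist) {κ' κ a C₁ C₂ : ℝ}
    (hκ : 0 ≤ κ) (ha : 0 < a) (hL : 1 < F.L)
    (hT : ∀ (K b : ℕ) (Y : Set (Site (F.P K) 0)), D.treeLen K (1 + b) Y ≤ D.treeLen (K + 1) (1 + (b + 1)) (refineSet F K Y))
    (hΨ₁ : KerHeightFree Ψ₁) (hΨ₂ : KerHeightFree Ψ₂) (h₁ : KernelRefOwnΦ D Φ Ψ₁ dist κ' κ a C₁) (h₂ : KernelRefOwnΦ D Φ Ψ₂ dist κ' κ a C₂)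
    (K b : ℕ) (Y : Set (Site (F.P K) 0)) {d : ℕ} (hd : d ∈ Finset.Ico 2 7) :
    ker Ψ₁ K b Y d = ker Ψ₂ K b Y d := by
  have hL1 : 1 ≤ F.L := hL.le
  set ρ : ℝ := ((F.L : ℝ)⁻¹) ^ a with hρdef
  have hρ1 : ρ < 1 := TwoCutoffKerHeightFree.ratio_lt_one hL ha
  have hρ0 : 0 ≤ ρ := by positivity
  -- step 0: both references are close to `Φ`, hence to each other, at every index
  have hbase : ∀ (K b : ℕ) (Y : Set (Site (F.P K) 0)),
      ‖(ker Ψ₁ K b Y d - ker Ψ₂ K b Y d).compContinuousLinearMap (fun _ => legL 𝕍 dist κ' K b Y)‖ ≤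
        (C₁ + C₂) * Real.exp (-κ * D.treeLen K (1 + b) Y) * (((F.L : ℝ) ^ (1 + b))⁻¹) ^ a := by
    intro K b Y
    have hsplit : ker Ψ₁ K b Y d - ker Ψ₂ K b Y d = (ker Φ K b Y d - ker Ψ₂ K b Y d) - (ker Φ K b Y d - ker Ψ₁ K b Y d) := by abel
    rw [hsplit, sub_compContinuousLinearMap]
    refine (norm_sub_le _ _).trans ?_
    calc _ ≤ C₂ * Real.exp (-κ * D.treeLen K (1 + b) Y) * (((F.L : ℝ) ^ (1 + b))⁻¹) ^ a +
          C₁ * Real.exp (-κ * D.treeLen K (1 + b) Y) * (((F.L : ℝ) ^ (1 + b))⁻¹) ^ a := add_le_add (h₂ K b Y d hd) (h₁ K b Y d hd)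
      _ = (C₁ + C₂) * Real.exp (-κ * D.treeLen K (1 + b) Y) * (((F.L : ℝ) ^ (1 + b))⁻¹) ^ a := by ring
  have hC : 0 ≤ C₁ + C₂ := by
    -- the budget at any index dominates a norm
    have h := hbase K b Y
    have hpos : 0 < Real.exp (-κ * D.treeLen K (1 + b) Y) * (((F.L : ℝ) ^ (1 + b))⁻¹) ^ a := by positivity
    nlinarith [norm_nonneg ((ker Ψ₁ K b Y d - ker Ψ₂ K b Y d).compContinuousLinearMap (fun _ => legL 𝕍 dist κ' K b Y)), h, hpos]
  -- climbing `n` steps: the bound improves by `ρ^n`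
  have hclimb : ∀ (n K b : ℕ) (Y : Set (Site (F.P K) 0)),
      ‖(ker Ψ₁ K b Y d - ker Ψ₂ K b Y d).compContinuousLinearMap (fun _ => legL 𝕍 dist κ' K b Y)‖ ≤
        (C₁ + C₂) * Real.exp (-κ * D.treeLen K (1 + b) Y) * (((F.L : ℝ) ^ (1 + b))⁻¹) ^ a * ρ ^ n := by
    intro n
    induction n with
    | zero => intro K b Y; rw [pow_zero, mul_one]; exact hbase K b Y
    | succ n ih =>
      intro K b Y
      refine (norm_sub_compLegL_le_succ_of_kerHeightFree hΨ₁ hΨ₂ hm κ' K b Y hd).trans ((ih (K + 1) (b + 1) (refineSet F K Y)).trans ?_)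
      have hstep := TwoCutoffKerHeightFree.k1aBudget_step_le (D := D) (a := a) hκ hC hL1 (hT K b Y)
      have hρn : 0 ≤ ρ ^ n := pow_nonneg hρ0 n
      calc (C₁ + C₂) * Real.exp (-κ * D.treeLen (K + 1) (1 + (b + 1)) (refineSet F K Y)) * (((F.L : ℝ) ^ (1 + (b + 1)))⁻¹) ^ a * ρ ^ n
          ≤ ρ * ((C₁ + C₂) * Real.exp (-κ * D.treeLen K (1 + b) Y) * (((F.L : ℝ) ^ (1 + b))⁻¹) ^ a) * ρ ^ n := mul_le_mul_of_nonneg_right hstep hρn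
        _ = (C₁ + C₂) * Real.exp (-κ * D.treeLen K (1 + b) Y) * (((F.L : ℝ) ^ (1 + b))⁻¹) ^ a * ρ ^ (n + 1) := by ring
  -- let `n → ∞`
  have hlim : Tendsto (fun n : ℕ => (C₁ + C₂) * Real.exp (-κ * D.treeLen K (1 + b) Y) * (((F.L : ℝ) ^ (1 + b))⁻¹) ^ a * ρ ^ n) atTop (𝓝 0) := by
    have h := (tendsto_pow_atTop_nhds_zero_of_lt_one hρ0 hρ1).const_mul ((C₁ + C₂) * Real.exp (-κ * D.treeLen K (1 + b) Y) * (((F.L : ℝ) ^ (1 + b))⁻¹) ^ a)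
    rwa [mul_zero] at h
  have hzero : ‖(ker Ψ₁ K b Y d - ker Ψ₂ K b Y d).compContinuousLinearMap (fun _ => legL 𝕍 dist κ' K b Y)‖ ≤ 0 :=
    ge_of_tendsto' hlim fun n => hclimb n K b Y
  have hW : (ker Ψ₁ K b Y d - ker Ψ₂ K b Y d).compContinuousLinearMap (fun _ => legL 𝕍 dist κ' K b Y) = 0 :=
    norm_le_zero_iff.mp hzero
  -- unweight: the leg weights are invertible
  have hM : ker Ψ₁ K b Y d - ker Ψ₂ K b Y d = 0 := by
    ext v
    have h := congrArg (fun M => M fun i => (legD 𝕍 dist κ' K b Y).symm (v i)) hW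
    simp only [ContinuousMultilinearMap.compContinuousLinearMap_apply, legL_apply, ContinuousLinearEquiv.apply_symm_apply] at h
    simpa using h
  exact sub_eq_zero.mp hM

end Unique

end Summit.QuantumFields.YangMills.Theorems.TwoCutoffRefUnique

end
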